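/-
Copyright: the b2b-balaban T⁴-continuum CRUX team, row NE7b OWNER lineage `t4-ne7b-p1` (gen 127). Project licence.
-/
import Summits.QuantumFields.BalabanUV.T4Continuum.Spine.NE7b.SupTorusFibreChart

/-!
# (109)'s EXPLICIT CHART OF THE ZERO-MEAN FIBRE, RE-EXPORTED WITH ITS LOCALITY: the chart `ζ ↦ (ζ(y,z) at the sites z ≠ 0 of block
# y, −Σ_{t≠0}ζ(y,t) at the block origin)` of (109) is BLOCK-LOCAL — the chart field of the index `(y, t)` vanishes off the torus block
# `y` — and its values are read off through the block chart; both facts were inside (109)'s proof, behind `∃ P`.  They are the chart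
# hypotheses of (273)∕(278)∕(280) (finite-range decomposition of the fluctuation covariance) on the torus, with locality radius `r = 0` in
# block distance (row NE7b, node U5c; (109)'s construction verbatim + two displayed clauses; [folklore])

Cell `pub-balaban`, sub-cell `t4`, spine estimate NE7b (`T4WeightBudget.RelWeightBound`; the cell's OWN estimate — NOT PRINTED in
[Bałaban 1983–89], NOT PROVED).  Crux-route work under `Spine/NE7b/` by the row OWNER (`t4-ne7b-p1` gen 127, file (279)) under FREEZE
(0)'s crux-prover clause, on § [NE7bP1-G126-HANDOFF] NEXT (3)(d) (the torus instance of (273)); NOTHING of Bałaban's is named as a Lean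
object, valued or asserted; no `T4Continuum/Support` leaf typed; no `def`, no notation; zero `sorry`.  Imports (BY NAME): the OWNER's (109)
`…SupTorusFibreChart` (`sum_split_zero`; import closure: (89) `SupTorusDirichletFormCoercive.torus_blockAvg_apply`, (86)
`SupTorusDirichletForm.siteOf_chart_bijective`, `blockOf_siteOf_of_mem`, the tree's `B6QGQLower276.chart_mem_B`).

WHY (located).  (273) needs, besides the chart bound and ceiling that (109) displays, the LOCALITY of the chart fields (`Pe_j` supported
within radius `r` of a home site) — for the block chart this is `r = 0` in block distance: `Pe_{(y,t)}` lives in block `y`.  (109) proved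
everything about one explicit `P` but exported it existentially without this clause; this file repeats the construction (verbatim) and
exports SIX clauses: the four of (109), the block-locality, and the evaluation formula through the block chart (so that no third copy of
the construction is ever needed).

WHAT IS PROVED ([folklore]; the `Beta.Site` carriers, every `d, n, s ≥ 1`): **`exists_fibreChart_local`** — `∃ P`, continuous linear on
`Site d s × {z // z ≠ 0} → ℝ`: (i) `Q′t(P ζ) = 0`; (ii) `Σ ζ² ≤ Σ(P ζ)²`; (iii) `Σ(P ζ)² ≤ ((n+1)^d + 1)·Σ ζ²`; (iv) every zero-mean field
is some `P ζ`; (v) BLOCK-LOCALITY: `P e_j x = 0` whenever the torus block of `x` is not `j.1`; (vi) the evaluation formula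
`P ζ (σ(chart n (wm y) z)) = if z = 0 then −Σ_t ζ(y,t) else ζ(y,z)`; §2 toy.

HONEST (what this is NOT).  A re-export of (109) with two more displayed clauses — no new mathematics; cubic periods; scalar skeleton
((A3), NC-NE7b-α UNRULED); nothing of Bałaban's asserted.  BY-NAME EFFECT ON THE WALL: NONE.  NE7b NOT PRINTED ∕ NOT PROVED; spine PROVED
0∕9; rung (B)+1 on a FINITE torus — NOT infinite volume, NOT the mass gap, NOT Clay.  HONEST DEPENDENCY: continuum YM on T⁴ ⇐ BetaPertH ∧
nine spine estimates (0∕9 proved); BetaPertH ⇐ (D1) ∧ (D4) ∧ CAP+tail; G-an2-4 gates asym, D1 and NE2∕3∕4.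
-/

set_option autoImplicit false

noncomputable section

namespace Summit.QuantumFields.BalabanUV.T4Continuum.NE7b.SupTorusFibreChartLocal

open Set Function Real
open scoped ENNReal
open Literature.MathematicalPhysics.QuantumFieldTheory.Balaban1983to89
open B6QGQLower276 (X blk B side chart chart_mem_B)
open Beta (Site siteOf windowMap)
open SupTorusDirichletForm (siteOf_chart_bijective blockOf_siteOf_of_mem)
open SupTorusDirichletFormCoercive (torus_blockAvg_apply)
open SupTorusFibreChart (sum_split_zero)

variable {d : ℕ}

/-! ## §1. The chart with its locality -/

section Chart

variable (n s : ℕ) [NeZero s]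
  {Dop : lp (fun _ : X d => ℝ) ∞ →L[ℝ] lp (fun _ : X d => ℝ) ∞}
  (hD : ∀ (f : lp (fun _ : X d => ℝ) ∞) (y : X d), Dop f y = (((n : ℝ) + 1) ^ d)⁻¹ * ∑ p ∈ B n y, f p)
  {Ef : (Site d ((n + 1) * s) → ℝ) →L[ℝ] lp (fun _ : X d => ℝ) ∞}
  (hEf : ∀ (g : Site d ((n + 1) * s) → ℝ) (q : X d), Ef g q = g (siteOf d ((n + 1) * s) q))
  {Rc : lp (fun _ : X d => ℝ) ∞ →L[ℝ] (Site d s → ℝ)}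
  (hRc : ∀ (h : lp (fun _ : X d => ℝ) ∞) (x : Site d s), Rc h x = h (windowMap d s x))

include hD hEf hRc in
/-- **THE EXPLICIT CHART OF THE ZERO-MEAN FIELDS, WITH LOCALITY**: there is a continuous linear
`P : (Site d s × {z // z ≠ 0} → ℝ) → (Site d ((n+1)s) → ℝ)` with (i) `Q′t(P ζ) = 0`, (ii)–(iii) `Σ ζ² ≤ Σ(P ζ)² ≤ ((n+1)^d + 1)·Σ ζ²`, (iv) every
zero-mean field in its range, (v) `P e_j x = 0` unless the torus block of `x` is `j.1`, and (vi) the evaluation formula through the block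
chart. [folklore] -/
theorem exists_fibreChart_local :
    ∃ P : ((Site d s × {z : Fin d → Fin (n + 1) // z ≠ 0}) → ℝ) →L[ℝ] (Site d ((n + 1) * s) → ℝ),
      (∀ ζ, ((Rc.comp Dop).comp Ef) (P ζ) = 0) ∧
      (∀ ζ, (1 : ℝ) * ∑ i, ζ i ^ 2 ≤ ∑ x, P ζ x ^ 2) ∧
      (∀ ζ, ∑ x, P ζ x ^ 2 ≤ (((n : ℝ) + 1) ^ d + 1) * ∑ i, ζ i ^ 2) ∧
      (∀ h : Site d ((n + 1) * s) → ℝ, ((Rc.comp Dop).comp Ef) h = 0 → ∃ ζ, P ζ = h) ∧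
      (∀ (j : Site d s × {z : Fin d → Fin (n + 1) // z ≠ 0}) (x : Site d ((n + 1) * s)),
        siteOf d s (blk n (windowMap d ((n + 1) * s) x)) ≠ j.1 → P (Pi.single j 1) x = 0) ∧
      (∀ (ζ : (Site d s × {z : Fin d → Fin (n + 1) // z ≠ 0}) → ℝ) (y : Site d s) (z : Fin d → Fin (n + 1)),
        P ζ (siteOf d ((n + 1) * s) (chart n (windowMap d s y) z))
          = if hz : z = 0 then -∑ t : {z : Fin d → Fin (n + 1) // z ≠ 0}, ζ (y, t) else ζ (y, ⟨z, hz⟩)) := by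
  classical
  -- TDF's block chart as an equivalence ((109) verbatim)
  set E : Site d s × (Fin d → Fin (n + 1)) ≃ Site d ((n + 1) * s) :=
    Equiv.ofBijective (fun yz : Site d s × (Fin d → Fin (n + 1)) => siteOf d ((n + 1) * s) (chart n (windowMap d s yz.1) yz.2))
      (siteOf_chart_bijective n s) with hE
  have hEapply : ∀ (y : Site d s) (z : Fin d → Fin (n + 1)), E (y, z) = siteOf d ((n + 1) * s) (chart n (windowMap d s y) z) :=
    fun y z => rfl
  -- the chart, fine site by fine site
  let L : Site d ((n + 1) * s) → ((Site d s × {z : Fin d → Fin (n + 1) // z ≠ 0}) → ℝ) →L[ℝ] ℝ := fun x =>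
    if hx : (E.symm x).2 = 0 then
      -∑ t : {z : Fin d → Fin (n + 1) // z ≠ 0},
        ContinuousLinearMap.proj (R := ℝ) (φ := fun _ : Site d s × {z : Fin d → Fin (n + 1) // z ≠ 0} => ℝ) ((E.symm x).1, t)
    else ContinuousLinearMap.proj (R := ℝ) (φ := fun _ : Site d s × {z : Fin d → Fin (n + 1) // z ≠ 0} => ℝ)
      ((E.symm x).1, ⟨(E.symm x).2, hx⟩)
  set P := ContinuousLinearMap.pi L with hP
  -- evaluation of the chart through the block chart
  have hPE : ∀ (ζ : (Site d s × {z : Fin d → Fin (n + 1) // z ≠ 0}) → ℝ) (y : Site d s) (z : Fin d → Fin (n + 1)),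
      P ζ (E (y, z)) = if hz : z = 0 then -∑ t : {z : Fin d → Fin (n + 1) // z ≠ 0}, ζ (y, t) else ζ (y, ⟨z, hz⟩) := by
    intro ζ y z
    rw [hP, ContinuousLinearMap.pi_apply]
    simp only [L, Equiv.symm_apply_apply]
    split_ifs with hz
    · simp only [neg_apply, sum_apply, ContinuousLinearMap.proj_apply]
    · simp only [ContinuousLinearMap.proj_apply]
  have hP0 : ∀ (ζ : (Site d s × {z : Fin d → Fin (n + 1) // z ≠ 0}) → ℝ) (y : Site d s),
      P ζ (E (y, 0)) = -∑ t : {z : Fin d → Fin (n + 1) // z ≠ 0}, ζ (y, t) := fun ζ y => by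
    rw [hPE, dif_pos rfl]
  have hPt : ∀ (ζ : (Site d s × {z : Fin d → Fin (n + 1) // z ≠ 0}) → ℝ) (y : Site d s)
      (t : {z : Fin d → Fin (n + 1) // z ≠ 0}), P ζ (E (y, t.1)) = ζ (y, t) := fun ζ y t => by
    rw [hPE, dif_neg t.2]
  -- block sums through the chart
  have hblocksum : ∀ (F : Site d ((n + 1) * s) → ℝ) (y : Site d s),
      ((Rc.comp Dop).comp Ef) F y = (((n : ℝ) + 1) ^ d)⁻¹ * ∑ z : Fin d → Fin (n + 1), F (E (y, z)) := fun F y => by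
    rw [ContinuousLinearMap.comp_apply, ContinuousLinearMap.comp_apply, torus_blockAvg_apply n s hD hEf hRc F y]
    rfl
  -- the sum of squares through the chart
  have hsumsq : ∀ ζ : (Site d s × {z : Fin d → Fin (n + 1) // z ≠ 0}) → ℝ,
      ∑ x, P ζ x ^ 2 = ∑ y : Site d s, ((∑ t : {z : Fin d → Fin (n + 1) // z ≠ 0}, ζ (y, t)) ^ 2
        + ∑ t : {z : Fin d → Fin (n + 1) // z ≠ 0}, ζ (y, t) ^ 2) := fun ζ => by
    rw [← E.sum_comp (fun x => P ζ x ^ 2), Fintype.sum_prod_type]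
    refine Finset.sum_congr rfl fun y _ => ?_
    rw [sum_split_zero n (fun z => P ζ (E (y, z)) ^ 2)]
    simp only [hP0, hPt, neg_sq]
  have hζsq : ∀ ζ : (Site d s × {z : Fin d → Fin (n + 1) // z ≠ 0}) → ℝ,
      ∑ i, ζ i ^ 2 = ∑ y : Site d s, ∑ t : {z : Fin d → Fin (n + 1) // z ≠ 0}, ζ (y, t) ^ 2 := fun ζ =>
    Fintype.sum_prod_type _
  -- the torus block of a block-chart site
  have hblk : ∀ (y : Site d s) (z : Fin d → Fin (n + 1)), siteOf d s (blk n (windowMap d ((n + 1) * s) (E (y, z)))) = y :=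
    fun y z => by rw [hEapply]; exact blockOf_siteOf_of_mem n s (chart_mem_B n (windowMap d s y) z)
  refine ⟨P, fun ζ => ?_, fun ζ => ?_, fun ζ => ?_, fun h hh => ?_, fun j x hx => ?_, fun ζ y z => hPE ζ y z⟩
  · -- (i) zero block means
    funext y
    rw [hblocksum, Pi.zero_apply, sum_split_zero n (fun z => P ζ (E (y, z)))]
    simp only [hP0, hPt, neg_add_cancel, mul_zero]
  · -- (ii) injectivity, constant `1`
    rw [one_mul, hsumsq, hζsq]
    exact Finset.sum_le_sum fun y _ => le_add_of_nonneg_left (sq_nonneg _)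
  · -- (iii) the ceiling `(n+1)^d + 1`
    rw [hsumsq, hζsq, Finset.mul_sum]
    refine Finset.sum_le_sum fun y _ => ?_
    have hCS := sq_sum_le_card_mul_sum_sq (s := (Finset.univ : Finset {z : Fin d → Fin (n + 1) // z ≠ 0}))
      (f := fun t => ζ (y, t))
    have hcard : ((Finset.univ : Finset {z : Fin d → Fin (n + 1) // z ≠ 0}).card : ℝ) ≤ ((n : ℝ) + 1) ^ d := by
      rw [Finset.card_univ]
      have h1 := Fintype.card_subtype_le (fun z : Fin d → Fin (n + 1) => z ≠ 0)
      have h2 : (Fintype.card (Fin d → Fin (n + 1)) : ℝ) = ((n : ℝ) + 1) ^ d := by simp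
      rw [← h2]
      exact_mod_cast h1
    have hS : 0 ≤ ∑ t : {z : Fin d → Fin (n + 1) // z ≠ 0}, ζ (y, t) ^ 2 := Finset.sum_nonneg fun t _ => sq_nonneg _
    nlinarith [mul_le_mul_of_nonneg_right hcard hS]
  · -- (iv) onto the zero-mean fields
    refine ⟨fun i => h (E (i.1, i.2.1)), funext fun x => ?_⟩
    obtain ⟨⟨y, z⟩, rfl⟩ := E.surjective x
    rw [hPE]
    split_ifs with hz
    · subst hz
      have hsum : ∑ z : Fin d → Fin (n + 1), h (E (y, z)) = 0 := by
        have hy := congr_fun hh y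
        rw [hblocksum, Pi.zero_apply] at hy
        have hvol : (((n : ℝ) + 1) ^ d)⁻¹ ≠ 0 := by positivity
        exact (mul_eq_zero.1 hy).resolve_left hvol
      rw [sum_split_zero n (fun z => h (E (y, z)))] at hsum
      linarith
    · rfl
  · -- (v) block-locality
    obtain ⟨⟨y, z⟩, rfl⟩ := E.surjective x
    rw [hblk] at hx
    have hj : ∀ t : {z : Fin d → Fin (n + 1) // z ≠ 0}, (Pi.single j (1 : ℝ) : _ → ℝ) (y, t) = 0 := fun t =>
      Pi.single_eq_of_ne (fun h => hx (congrArg Prod.fst h)) _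
    rw [hPE]
    split_ifs with hz
    · simp only [hj, Finset.sum_const_zero, neg_zero]
    · exact hj _

end Chart

/-! ## §2. Toy -/

/-- Toy: a single-index function vanishes off its index (the mechanism of clause (v)). -/
example (j i : Fin 3 × Fin 2) (h : i.1 ≠ j.1) : (Pi.single j (1 : ℝ) : _ → ℝ) i = 0 :=
  Pi.single_eq_of_ne (fun e => h (congrArg Prod.fst e)) _

end Summit.QuantumFields.BalabanUV.T4Continuum.NE7b.SupTorusFibreChartLocal
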